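import Literature.Barriers.RiemannHypothesis.NymanBeurlingObstructions
import Literature.NumberTheory.LFunctions.BaezDuarteLowerBound
import HarnessLib

/-!
# BDBLS 2000: every Beurling approximation is slow, `‖χ - Σ c_k ρ_{a_k}‖₂ ≥ C/√log N` — discharged

Barrier catalogue `Literature/Barriers/RiemannHypothesis/`, second companion ("Proofs") file of
`NymanBeurlingObstructions.lean` (the first, `NymanBeurlingObstructionsProofs.lean`, discharges
Báez-Duarte 2000 Prop. 4.4). It discharges the named fact
`Literature.Barriers.RiemannHypothesis.BDBLS2000_uniform` — Báez-Duarte–Balazard–Landreau–Saias 2000, as printed in Báez-Duarte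
2003, §1 (1.3): "for any `F = Σ_{k=1}^n c_k ρ_{a_k}`, `a_k ≥ 1`, if `N = max a_k`, then
`‖F - χ‖_𝓗 ≥ C/√log N` for an absolute constant `C`" — as `Literature.Barriers.RiemannHypothesis.BDBLS2000_uniform_holds`,
fully proved (no named fact assumed; axioms `propext`, `Classical.choice`, `Quot.sound`).

The analysis is `Literature.NumberTheory.LFunctions.BaezDuarteU.lowerBound_real`
(`Literature/NumberTheory/LFunctions/BaezDuarteLowerBound.lean`, whose module docstring describes
the argument: one zero `1/2 + iγ` of `ζ` on the critical line (Hardy), the test vectors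
`t^{w̄-1}𝟙_{(0,1]}` with `w → 1/2 + iγ`, Báez-Duarte's unitary `U` realised through Mellin–Plancherel,
`Uχ = sin(2πt)/(πt)`); here we only identify the barrier file's `genError a c` with
`‖χ - Σ c_k ρ_{a_k}‖_{L²(0,∞)} = √(∫_0^∞ |nbFun a c|²)`.

## References

* [BDBLS2000] L. Báez-Duarte, M. Balazard, B. Landreau, E. Saias, *Notes sur la fonction ζ de
  Riemann, 3*, Adv. Math. 149 (2000), 130–144.
* [BaezDuarte2003] L. Báez-Duarte, Rend. Lincei (9) 14 (2003), 5–11 (arXiv:math/0202141), §1 (1.3).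
-/

noncomputable section

open Complex MeasureTheory Set Filter
open scoped Real Topology
open Literature.NumberTheory.LFunctions Literature.NumberTheory.LFunctions.BaezDuarteU

namespace Literature.Barriers.RiemannHypothesis

namespace BDBLS2000

variable {n : ℕ} (a c : Fin n → ℝ)

/-- The quantity `genError a c` is the `L²(0,∞)` norm of `nbFun a c`:
`genError a c = ofReal √(∫_0^∞ |f|²)`. [folklore] -/
theorem genError_eq (ha : ∀ j, 1 ≤ a j) :
    genError a c = ENNReal.ofReal (Real.sqrt (∫ t in Ioi (0 : ℝ), ‖nbFun a c t‖ ^ 2)) := by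
  unfold genError l2Ioi
  have h1 : eLpNorm (fun x ↦ nbChi x - ∑ j, c j * beurlingRho (a j) x) 2 (volume.restrict (Ioi 0)) =
      eLpNorm (nbFun a c) 2 (volume.restrict (Ioi 0)) := by
    refine eLpNorm_congr_norm_ae (Eventually.of_forall fun x ↦ ?_)
    simp only [nbFun, nbChi, beurlingRho, Complex.norm_real]
  rw [h1, MemLp.eLpNorm_eq_integral_rpow_norm (by norm_num) (by norm_num) (memLp_two_nbFun a c ha)]
  congr 1
  rw [Real.sqrt_eq_rpow]
  norm_num

end BDBLS2000


/-- **Discharge of `Literature.Barriers.RiemannHypothesis.BDBLS2000_uniform`** (Báez-Duarte–Balazard–Landreau–Saias 2000, as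
printed in Báez-Duarte 2003, §1, (1.3)): there is an absolute constant `C > 0` such that for any
`F = Σ_k c_k ρ_{a_k}` with real dilations `1 ≤ a_k ≤ N` and `N ≥ 2`,
`‖χ - F‖_{L²(0,∞)} ≥ C/√log N`. Proof: `Literature.NumberTheory.LFunctions.BaezDuarteU.lowerBound_real` (one zero
`ρ = 1/2+iγ` of `ζ` on the critical line — Hardy — the test vectors `t^{w̄-1}𝟙_{(0,1]}`, `w → ρ`,
Báez-Duarte's unitary `U` through Mellin–Plancherel, and `Uχ = sin(2πt)/(πt)`; see the module
docstring). [cite: BaezDuarte2003, §1 (1.3)] [cite: BDBLS2000, main theorem] -/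
theorem BDBLS2000_uniform_holds : BDBLS2000_uniform := by
  obtain ⟨C, hC, h⟩ := lowerBound_real
  refine ⟨C, hC, fun n a c N haN hN ↦ ?_⟩
  rw [BDBLS2000.genError_eq a c fun j ↦ (haN j).1]
  exact ENNReal.ofReal_le_ofReal (h n a c N haN hN)

end Literature.Barriers.RiemannHypothesis
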